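import Summits.QuantumFields.YangMills.Theorems.Instrument.BesselRatioEnclosures
import Literature.Analysis.FunctionSpaces.BesselIIntegralSeries
import HarnessLib

/-!
# Instrument cell `ym-instrument`, crew (b) (RT-χ activity column / Q-B2(c)): the TAIL of the character-activity sum —
# `Σ_{l ≥ L} l²·I_l(x) ≤ I₀(x)·a_L/(1 − ρ_L)`, `a_L = L²(x/2)^L/L!`, `ρ_L = (L+1)(x/2)/L²` — and its kernel-checked instance at `β_W = 9/25`, `L = 8`

QUESTIONS.md rows: Q-B1 / Q-B2 (REGISTERED 2026-08-26T13:54:11Z; A-0826-8; RADIUS-DERIVATION (1.4) activity `w = Σ_j (2j+1)² v_j`); cell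
`run/shared/lean/pub/ym-instrument/`, HUMAN RULING D-0084 (2), director-ym R138; no currency row.  HONEST FRAMING (page 1, binding).  WHAT IS CERTIFIED HERE
AND AT WHICH `(G, D, L, β)`: NOTHING about any lattice gauge theory; pure one-variable analysis of the tree's integral-defined modified Bessel functions
`Literature.Analysis.FunctionSpaces.besselI`.  With `d = l = 2j+1 ∈ {2, 3, …}` the per-plaquette character-activity sum of the `SU(2)` strong-coupling
expansion is `w(β_W) = Σ_{l ≥ 2} l²·I_l(β_W)/I₁(β_W)` (RADIUS-DERIVATION (1.4), `= 4u + 9v₁ + …`); the landed table `Instrument.BesselRatioTable` encloses the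
terms `l = 2 … 7`; THIS file bounds the REST: from the tree's `besselI_le_pow_div_factorial_mul` (`I_l(x) ≤ (x/2)^l/l!·I₀(x)`, `x ≥ 0`) and the ratio bound
`a_{l+1} ≤ ρ_L·a_l` for `l ≥ L ≥ 1` of the majorant `a_l = l²(x/2)^l/l!`, the tail `Σ_{j ≥ 0} (L+j)²·I_{L+j}(x)` is summable and `≤ I₀(x)·a_L/(1 − ρ_L)` whenever
`ρ_L = (L+1)(x/2)/L² < 1` (★ `sq_mul_besselI_tail_le`); dividing by `I₁(x) > 0` and enclosing `I₀/I₁` with the landed checker `besselRatioCheck` gives a RATIONAL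
bound, e.g. ★ `charTail_036_L8`: `Σ_{j≥0} (8+j)²·I_{8+j}(9/25)/I₁(9/25) ≤ 1013080/10¹⁴ < 1.02·10⁻⁸` — so at `β_W = 0.36` the activity `w` is the six table terms plus at most
`1.02·10⁻⁸`.  NOT a mass, NOT a radius, NOT summit-bearing; what `w` bounds in the polymer expansion is RADIUS-DERIVATION's business (GAP-STATED there), not this file's.
-/

noncomputable section

open Real Finset
open scoped Nat
open Literature.Analysis.FunctionSpaces (besselI besselI_nonneg besselI_le_pow_div_factorial_mul)
open Summit.QuantumFields.YangMills.Theorems.Instrument.BesselRatioEnclosures (besselRatioCheck besselRatioCheck_sound bPartialQ bracket_cast)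

namespace Summit.QuantumFields.YangMills.Theorems.Instrument.BesselCharacterSumTail

/-! ## §1 The majorant `a_l = l²(x/2)^l/l!` and its ratio bound -/

/-- The majorant term `a_l(x) = l²·(x/2)^l/l!`. [folklore] -/
def aTerm (x : ℝ) (l : ℕ) : ℝ := (l : ℝ) ^ 2 * (x / 2) ^ l / (l ! : ℝ)

/-- `a_l ≥ 0` for `x ≥ 0`. [folklore] -/
theorem aTerm_nonneg {x : ℝ} (hx : 0 ≤ x) (l : ℕ) : 0 ≤ aTerm x l := by
  unfold aTerm; positivity

/-- The exact ratio: `a_{l+1} = a_l · (l+1)(x/2)/l²` for `l ≥ 1`. [folklore] -/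
theorem aTerm_succ {x : ℝ} {l : ℕ} (hl : 1 ≤ l) :
    aTerm x (l + 1) = aTerm x l * (((l : ℝ) + 1) * (x / 2) / (l : ℝ) ^ 2) := by
  unfold aTerm
  have hl0 : (0 : ℝ) < l := by exact_mod_cast hl
  have hf : (0 : ℝ) < (l ! : ℝ) := by exact_mod_cast Nat.factorial_pos l
  rw [Nat.factorial_succ]
  push_cast
  field_simp
  ring

/-- **Ratio bound**: for `1 ≤ L ≤ l` and `x ≥ 0`, `a_{l+1} ≤ a_l · ρ_L` with `ρ_L = (L+1)(x/2)/L²` (`(l+1)/l²` is non-increasing). [folklore] -/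
theorem aTerm_succ_le {x : ℝ} (hx : 0 ≤ x) {L l : ℕ} (hL : 1 ≤ L) (hl : L ≤ l) :
    aTerm x (l + 1) ≤ aTerm x l * (((L : ℝ) + 1) * (x / 2) / (L : ℝ) ^ 2) := by
  rw [aTerm_succ (hL.trans hl)]
  refine mul_le_mul_of_nonneg_left ?_ (aTerm_nonneg hx l)
  have hL0 : (0 : ℝ) < L := by exact_mod_cast hL
  have hl0 : (0 : ℝ) < l := by exact_mod_cast (hL.trans hl)
  have hLl : (L : ℝ) ≤ l := by exact_mod_cast hl
  rw [div_le_div_iff₀ (by positivity) (by positivity)]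
  have hx2 : 0 ≤ x / 2 := by positivity
  have key : ((l : ℝ) + 1) * (L : ℝ) ^ 2 ≤ ((L : ℝ) + 1) * (l : ℝ) ^ 2 := by nlinarith [mul_nonneg hL0.le (sub_nonneg.2 hLl)]
  calc ((l : ℝ) + 1) * (x / 2) * (L : ℝ) ^ 2 = (x / 2) * (((l : ℝ) + 1) * (L : ℝ) ^ 2) := by ring
    _ ≤ (x / 2) * (((L : ℝ) + 1) * (l : ℝ) ^ 2) := mul_le_mul_of_nonneg_left key hx2
    _ = ((L : ℝ) + 1) * (x / 2) * (l : ℝ) ^ 2 := by ring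

/-- Geometric domination from `L` on: `a_{L+j} ≤ a_L · ρ_L^j`. [folklore] -/
theorem aTerm_add_le {x : ℝ} (hx : 0 ≤ x) {L : ℕ} (hL : 1 ≤ L) (j : ℕ) :
    aTerm x (L + j) ≤ aTerm x L * (((L : ℝ) + 1) * (x / 2) / (L : ℝ) ^ 2) ^ j := by
  induction j with
  | zero => simp
  | succ j ih =>
    have hρ : 0 ≤ ((L : ℝ) + 1) * (x / 2) / (L : ℝ) ^ 2 := by positivity
    rw [show L + (j + 1) = (L + j) + 1 by omega, pow_succ]
    calc aTerm x (L + j + 1) ≤ aTerm x (L + j) * (((L : ℝ) + 1) * (x / 2) / (L : ℝ) ^ 2) :=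
          aTerm_succ_le hx hL (Nat.le_add_right L j)
      _ ≤ aTerm x L * (((L : ℝ) + 1) * (x / 2) / (L : ℝ) ^ 2) ^ j * (((L : ℝ) + 1) * (x / 2) / (L : ℝ) ^ 2) :=
          mul_le_mul_of_nonneg_right ih hρ
      _ = _ := by ring

/-! ## §2 ★ The tail of `Σ l²·I_l(x)` -/

/-- Each term is dominated: `l²·I_l(x) ≤ a_l(x)·I₀(x)` (tree `besselI_le_pow_div_factorial_mul`). [folklore] -/
theorem sq_mul_besselI_le {x : ℝ} (hx : 0 ≤ x) (l : ℕ) : (l : ℝ) ^ 2 * besselI l x ≤ aTerm x l * besselI 0 x := by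
  unfold aTerm
  have h := besselI_le_pow_div_factorial_mul l hx
  calc (l : ℝ) ^ 2 * besselI l x ≤ (l : ℝ) ^ 2 * ((x / 2) ^ l / (l ! : ℝ) * besselI 0 x) :=
        mul_le_mul_of_nonneg_left h (by positivity)
    _ = (l : ℝ) ^ 2 * (x / 2) ^ l / (l ! : ℝ) * besselI 0 x := by ring

/-- ★ **THE TAIL BOUND.**  For `x ≥ 0`, `L ≥ 1` and `ρ_L = (L+1)(x/2)/L² < 1`: the tail `j ↦ (L+j)²·I_{L+j}(x)` is summable and
`Σ_{j ≥ 0} (L+j)²·I_{L+j}(x) ≤ I₀(x)·a_L(x)/(1 − ρ_L)`. [folklore] -/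
theorem sq_mul_besselI_tail_le {x : ℝ} (hx : 0 ≤ x) {L : ℕ} (hL : 1 ≤ L) (hρ : ((L : ℝ) + 1) * (x / 2) / (L : ℝ) ^ 2 < 1) :
    Summable (fun j : ℕ => (((L + j : ℕ) : ℝ)) ^ 2 * besselI (L + j) x) ∧
      ∑' j : ℕ, (((L + j : ℕ) : ℝ)) ^ 2 * besselI (L + j) x ≤ besselI 0 x * aTerm x L / (1 - ((L : ℝ) + 1) * (x / 2) / (L : ℝ) ^ 2) := by
  set ρ : ℝ := ((L : ℝ) + 1) * (x / 2) / (L : ℝ) ^ 2 with hρdef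
  have hρ0 : 0 ≤ ρ := by positivity
  have hI0 : 0 ≤ besselI 0 x := besselI_nonneg 0 hx
  have hgeo : HasSum (fun j : ℕ => besselI 0 x * aTerm x L * ρ ^ j) (besselI 0 x * aTerm x L * (1 - ρ)⁻¹) :=
    (hasSum_geometric_of_lt_one hρ0 hρ).mul_left _
  have hnn : ∀ j : ℕ, 0 ≤ (((L + j : ℕ) : ℝ)) ^ 2 * besselI (L + j) x := fun j =>
    mul_nonneg (by positivity) (besselI_nonneg _ hx)
  have hle : ∀ j : ℕ, (((L + j : ℕ) : ℝ)) ^ 2 * besselI (L + j) x ≤ besselI 0 x * aTerm x L * ρ ^ j := fun j =>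
    calc (((L + j : ℕ) : ℝ)) ^ 2 * besselI (L + j) x ≤ aTerm x (L + j) * besselI 0 x := sq_mul_besselI_le hx (L + j)
      _ ≤ aTerm x L * ρ ^ j * besselI 0 x := mul_le_mul_of_nonneg_right (aTerm_add_le hx hL j) hI0
      _ = besselI 0 x * aTerm x L * ρ ^ j := by ring
  have hsum : Summable (fun j : ℕ => (((L + j : ℕ) : ℝ)) ^ 2 * besselI (L + j) x) :=
    Summable.of_nonneg_of_le hnn hle hgeo.summable
  refine ⟨hsum, ?_⟩
  have h := hasSum_le hle hsum.hasSum hgeo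
  rw [div_eq_mul_inv]
  exact h

/-- **The normalised tail** (divide by `I₁(x) > 0`): with an upper enclosure `I₀(x)/I₁(x) ≤ r` and `R ≥ r·a_L/(1 − ρ_L)`,
`Σ_{j ≥ 0} (L+j)²·I_{L+j}(x)/I₁(x) ≤ R` — the shape the activity column consumes. [folklore] -/
theorem sq_mul_besselI_div_tail_le {x : ℝ} (hx : 0 ≤ x) (hI1 : 0 < besselI 1 x) {L : ℕ} (hL : 1 ≤ L)
    (hρ : ((L : ℝ) + 1) * (x / 2) / (L : ℝ) ^ 2 < 1) {r R : ℝ} (hr : besselI 0 x / besselI 1 x ≤ r)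
    (hR : r * aTerm x L / (1 - ((L : ℝ) + 1) * (x / 2) / (L : ℝ) ^ 2) ≤ R) :
    Summable (fun j : ℕ => (((L + j : ℕ) : ℝ)) ^ 2 * besselI (L + j) x / besselI 1 x) ∧
      ∑' j : ℕ, (((L + j : ℕ) : ℝ)) ^ 2 * besselI (L + j) x / besselI 1 x ≤ R := by
  obtain ⟨hs, ht⟩ := sq_mul_besselI_tail_le hx hL hρ
  refine ⟨hs.div_const _, ?_⟩
  rw [tsum_div_const, div_le_iff₀ hI1]
  have h1ρ : 0 < 1 - ((L : ℝ) + 1) * (x / 2) / (L : ℝ) ^ 2 := by linarith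
  have haL : 0 ≤ aTerm x L := aTerm_nonneg hx L
  have hI0le : besselI 0 x ≤ r * besselI 1 x := by rwa [div_le_iff₀ hI1] at hr
  calc ∑' j : ℕ, (((L + j : ℕ) : ℝ)) ^ 2 * besselI (L + j) x
      ≤ besselI 0 x * aTerm x L / (1 - ((L : ℝ) + 1) * (x / 2) / (L : ℝ) ^ 2) := ht
    _ ≤ (r * besselI 1 x) * aTerm x L / (1 - ((L : ℝ) + 1) * (x / 2) / (L : ℝ) ^ 2) := by gcongr
    _ = (r * aTerm x L / (1 - ((L : ℝ) + 1) * (x / 2) / (L : ℝ) ^ 2)) * besselI 1 x := by ring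
    _ ≤ R * besselI 1 x := mul_le_mul_of_nonneg_right hR hI1.le

/-! ## §3 The kernel-checked instance at `β_W = 9/25`, `L = 8` -/

/-- `I₀(9/25)/I₁(9/25) ≤ 5645073458440·10⁻¹²` (`= 5.6450734584…`; landed checker, `decide +kernel`). [folklore] -/
theorem besselI_zero_div_one_036_le :
    besselI 0 ((9 : ℝ) / 25) / besselI 1 ((9 : ℝ) / 25) ≤ (5645073458440 : ℝ) / 1000000000000 := by
  have h := besselRatioCheck_sound (n := 0) (m := 1) (x := 9 / 25) (lo := 5645073458439 / 1000000000000)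
    (hi := 5645073458440 / 1000000000000) (Kn := 8) (Km := 8) (by decide +kernel)
  push_cast at h
  exact h.2

/-- `I₁(9/25) > 0` (its 8-term partial sum is positive, landed bracket `bracket_cast`). [folklore] -/
theorem besselI_one_036_pos : 0 < besselI 1 ((9 : ℝ) / 25) := by
  have hb := bracket_cast 1 (x := 9 / 25) (by norm_num) (K := 8) (by decide +kernel)
  have hP : (0 : ℝ) < ((bPartialQ 1 (9 / 25) 8 : ℚ) : ℝ) := by exact_mod_cast (by decide +kernel : (0 : ℚ) < bPartialQ 1 (9 / 25) 8)
  have h := lt_of_lt_of_le hP hb.1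
  push_cast at h
  exact h

/-- ★ **`β_W = 9/25`, `L = 8`**: `Σ_{j ≥ 0} (8+j)²·I_{8+j}(0.36)/I₁(0.36) ≤ 1013080/10¹⁴` (`< 1.02·10⁻⁸`; `ρ₈ = 81/3200`, `a₈ = 64·(9/50)⁸/8!`).
With the landed table rows `l = 2 … 7` this closes the activity sum `w(0.36) = Σ_{l ≥ 2} l² I_l/I₁` to `±1.02·10⁻⁸`. [folklore] -/
theorem charTail_036_L8 :
    Summable (fun j : ℕ => (((8 + j : ℕ) : ℝ)) ^ 2 * besselI (8 + j) ((9 : ℝ) / 25) / besselI 1 ((9 : ℝ) / 25)) ∧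
      ∑' j : ℕ, (((8 + j : ℕ) : ℝ)) ^ 2 * besselI (8 + j) ((9 : ℝ) / 25) / besselI 1 ((9 : ℝ) / 25) ≤ (1013080 : ℝ) / 100000000000000 := by
  refine sq_mul_besselI_div_tail_le (by norm_num) besselI_one_036_pos (by norm_num) (by norm_num) besselI_zero_div_one_036_le ?_
  unfold aTerm
  norm_num [Nat.factorial]

end Summit.QuantumFields.YangMills.Theorems.Instrument.BesselCharacterSumTail

end
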